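import Summits.ABC.ABC.Theses.IsogenyGlueCongruence
import Literature.NumberTheory.EllipticCurves.AbelianVarietyBridgeProofs
import Literature.NumberTheory.EllipticCurves.RationalIsogenyDegreesProofs
import Literature.AlgebraicGeometry.Motives.AbelianVarietyDimZeroProofs
import Literature.AlgebraicGeometry.Motives.VarietiesUnitProofs
import Literature.AlgebraicGeometry.Motives.VarietiesGeometricallyIntegralProofs
import Literature.AlgebraicGeometry.Motives.VarietiesDimensionProofs

/-!
# `EllipticGluingPrimeBound` (stmt-ABC-13919) · Negative · load-bearing hypotheses and calibration

Negative-side knowledge for crux U = `IsogenyGlueCongruence.EllipticGluingPrimeBound` (a prime dividing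
every `E`-multiplier of an abelian variety `B/ℚ` is `≤ C (dim B · max 1 h_F(W))^κ`, absolute `κ, C`),
extracted from the standing disprover's work file `Cruxes/EllipticGluingPrimeBound/Disproof.lean`
(refuter-cdisprove-stmt-ABC-13919-0, cycle 1, 2026-08-16) for ideators, planners and provers to import.
Unconditional except the two results "modulo H_Res", which take the paper family
`WeilRestrictionFamily` (Weil restrictions along cyclic fields of prime degree; not constructible in
the tree) as an explicit hypothesis. No theorem asserts a Theses decl positively.

* normalisations (PROVED): `iff_normalised` (WLOG `κ ≥ 1`, `C ≥ 0`), `iff_boundAbove` (WLOG `ℓ > L₀`);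
* `zsmul_id_eq_zero_iff` (`End E` torsion-free, from `#W[n] = n²`), `zeroAbelianVariety` (genuine,
  `dim 0`); degenerate instances excluded: `not_forall_dvd_self` (`B = E`),
  `not_exists_multiplier_of_dim_eq_zero` (`dim B = 0`);
* load-bearing, with explicit witnesses: `ellipticGluingPrimeBound_false_without_neZero`,
  `ellipticGluingPrimeBound_false_without_forallDvd`, `not_existsForm`; each variant implies U
  (`of_withoutNeZero`, `of_withoutForallDvd`, `of_withoutDim`);
* modulo H_Res: `not_withoutDim_of_weilRestrictionFamily`, `one_le_kappa_of_weilRestrictionFamily`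
  (`Bound κ C → 1 ≤ κ`; real-analysis core `one_le_of_forall_prime_le` unconditional).
-/

noncomputable section

open CategoryTheory MonoidalCategory AlgebraicGeometry Filter
open Literature.AlgebraicGeometry.Motives
open Summit.ABC.ABC.Theses.IsogenyGlueCongruence

-- `Summit.<Summit>.<Sub>` is the mandated summit-side namespace (CONVENTIONS §2); for the
-- single-conjunct summit `ABC` the two coincide, so the duplicate `ABC.ABC` is deliberate.
set_option linter.dupNamespace false

namespace Summit.ABC.ABC.Theorems.EllipticGluingPrimeBound.Negative

/-! ## §0 The crux with its constants named; normalisations -/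

/-- `Bound κ C`: the inner statement of the crux `EllipticGluingPrimeBound` for FIXED constants
`κ, C` (so that `EllipticGluingPrimeBound ↔ ∃ κ C, 0 ≤ κ ∧ Bound κ C`, `iff_exists_bound`). -/
def Bound (κ C : ℝ) : Prop :=
  ∀ (W : WeierstrassCurve ℚ) [W.IsElliptic] (E B : AbelianVariety.{0} ℚ)
    (e : E.geomPoints ≃+ W.geomPoints),
    (∀ (σ : Field.absoluteGaloisGroup ℚ) (P : E.geomPoints), e (σ • P) = σ • e P) →
    ∀ ℓ : ℕ, ℓ.Prime →
      (∃ (α : E ⟶ B) (β : B ⟶ E) (n : ℤ), n ≠ 0 ∧ α ≫ β = n • 𝟙 E) →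
      (∀ (α : E ⟶ B) (β : B ⟶ E) (n : ℤ), α ≫ β = n • 𝟙 E → (ℓ : ℤ) ∣ n) →
        (ℓ : ℝ) ≤ C * ((B.dim : ℝ) * max 1 W.stableFaltingsHeight) ^ κ

/-- The crux is `∃ κ C, 0 ≤ κ ∧ Bound κ C` (definitional unfolding). [folklore] -/
theorem iff_exists_bound : EllipticGluingPrimeBound ↔ ∃ κ C : ℝ, 0 ≤ κ ∧ Bound κ C := Iff.rfl

/-! ## §1 Models, multipliers, degenerate instances -/

/-- `[n]` acts on geometric points as multiplication by `n` (additivity of `f ↦ f(ℚ̄)`,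
Mumford §19). [folklore] -/
theorem geomPointsMap_zsmul_id (E : AbelianVariety.{0} ℚ) (n : ℤ) :
    AbelianVariety.Hom.geomPointsMap (n • 𝟙 E) = n • AddMonoidHom.id E.geomPoints := by
  rw [← AbelianVariety.Hom.geomPointsMapAddMonoidHom_apply, map_zsmul,
    AbelianVariety.Hom.geomPointsMapAddMonoidHom_apply, AbelianVariety.Hom.geomPointsMap_id]

/-- **`End E` is torsion-free for a model `E` of an elliptic curve**: `n • 𝟙 E = 0 ↔ n = 0`
(`[n] = 0` would give `W[n] = W[2n] = W(ℚ̄)`, against `#W[n] = n²`, `#W[2n] = 4n²`; cf. the tree's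
`≠`-form `Summit.ABC.ABC.Theorems.zsmul_id_ne_zero_of_geomPoints_equiv`). [cite: SilvermanAEC2009, Cor. III.6.4(b)] -/
theorem zsmul_id_eq_zero_iff {W : WeierstrassCurve ℚ} [W.IsElliptic] {E : AbelianVariety.{0} ℚ}
    (e : E.geomPoints ≃+ W.geomPoints) {n : ℤ} : n • 𝟙 E = 0 ↔ n = 0 := by
  refine ⟨fun h ↦ ?_, fun h ↦ by rw [h, zero_smul]⟩
  by_contra hn
  have hpt : ∀ P : E.geomPoints, n • P = 0 := fun P ↦ by
    have h1 := congrArg (fun f : E.geomPoints →+ E.geomPoints ↦ f P) (geomPointsMap_zsmul_id E n)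
    simp only [h, AbelianVariety.Hom.geomPointsMap_zero, AddMonoidHom.zero_apply] at h1
    rw [h1]
    rfl
  have hW : ∀ (m : ℤ) (Q : W.geomPoints), (m * n) • Q = 0 := fun m Q ↦ by
    rw [mul_smul, ← e.apply_symm_apply Q, ← map_zsmul e n, hpt, map_zero, smul_zero]
  have htop : ∀ m : ℤ, W.geomTorsion (m * n) = ⊤ := fun m ↦ by
    rw [eq_top_iff]
    intro Q _
    exact (Submodule.mem_torsionBy_iff (m * n) Q).2 (hW m Q)
  have h1 := Literature.NumberTheory.EllipticCurves.natCard_geomTorsion_int_eq_sq W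
    (mul_ne_zero one_ne_zero hn)
  have h2 := Literature.NumberTheory.EllipticCurves.natCard_geomTorsion_int_eq_sq W
    (mul_ne_zero two_ne_zero hn)
  rw [htop 1] at h1
  rw [htop 2, h1, Int.natAbs_mul, Int.natAbs_mul] at h2
  have h3 : n.natAbs ^ 2 = 4 * n.natAbs ^ 2 := by simpa [mul_pow] using h2
  have h4 : n.natAbs ^ 2 = 0 := by omega
  exact hn (Int.natAbs_eq_zero.1 (pow_eq_zero_iff two_ne_zero |>.1 h4))

/-- **Multipliers are closed under integer scaling**: `α ≫ β = [n]` gives `(m • α) ≫ β = [mn]` — so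
"ℓ divides SOME non-zero multiplier" carries no information (`not_existsForm`). [folklore] -/
theorem zsmul_multiplier {E B : AbelianVariety.{0} ℚ} {α : E ⟶ B} {β : B ⟶ E} {n : ℤ}
    (h : α ≫ β = n • 𝟙 E) (m : ℤ) : (m • α) ≫ β = (m * n) • 𝟙 E := by
  rw [Preadditive.zsmul_comp, h, smul_smul]

/-- **Degenerate instance `B = E` is excluded**: `1 = 𝟙 ≫ 𝟙` is a multiplier, so no prime divides
every `E`-multiplier of `E`. [folklore] -/
theorem not_forall_dvd_self (E : AbelianVariety.{0} ℚ) {ℓ : ℕ} (hℓ : ℓ.Prime) :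
    ¬ ∀ (α : E ⟶ E) (β : E ⟶ E) (n : ℤ), α ≫ β = n • 𝟙 E → (ℓ : ℤ) ∣ n := by
  intro h
  have h1 : (ℓ : ℤ) ∣ 1 := h (𝟙 E) (𝟙 E) 1 (by rw [Category.comp_id, one_smul])
  have h2 : (ℓ : ℤ) = 1 := Int.eq_one_of_dvd_one (by positivity) h1
  exact hℓ.one_lt.ne' (by exact_mod_cast h2)

/-- **The zero abelian variety over `ℚ`**: `Spec ℚ` with the trivial group law (monoidal unit of
`SchemeOver ℚ`, Mathlib `GrpObj.instTensorUnit`); proper as an identity, geometrically integral by the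
tree's PROVED facts on the `0`-fold `Spec ℚ`. A genuine inhabitant of dimension `0`. -/
def zeroAbelianVariety : AbelianVariety.{0} ℚ where
  X := 𝟙_ (SchemeOver ℚ)
  grpObj := GrpObj.instTensorUnit
  isProper := inferInstanceAs (IsProper (𝟙 (Spec (.of ℚ))))
  geometricallyIntegral :=
    IsSmoothProjective.geometricallyIntegral_holds (isSmoothProjective_unit_holds ℚ)

/-- `dim 0 = 0` (`schemeDim_eq_holds` for the `0`-fold `Spec ℚ`). [folklore] -/
theorem zeroAbelianVariety_dim : zeroAbelianVariety.dim = 0 :=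
  schemeDim_eq_holds (isSmoothProjective_unit_holds ℚ)

/-- **Degenerate instance `dim B = 0` is excluded**: `Hom(B, E) = 0`
(`hom_eq_zero_of_dim_eq_zero_left`, PROVED in the tree), so every multiplier is `0` by
torsion-freeness of `End E`; no non-zero multiplier exists. [folklore] -/
theorem not_exists_multiplier_of_dim_eq_zero {W : WeierstrassCurve ℚ} [W.IsElliptic]
    {E B : AbelianVariety.{0} ℚ} (e : E.geomPoints ≃+ W.geomPoints) (hB : B.dim = 0) :
    ¬ ∃ (α : E ⟶ B) (β : B ⟶ E) (n : ℤ), n ≠ 0 ∧ α ≫ β = n • 𝟙 E := by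
  rintro ⟨α, β, n, hn, h⟩
  rw [AbelianVariety.hom_eq_zero_of_dim_eq_zero_left B hB β, Limits.comp_zero] at h
  exact hn ((zsmul_id_eq_zero_iff e).1 h.symm)

/-- In every instance of the crux's hypotheses, `dim B ≠ 0` (contrapositive of the above): the base
`dim B · max 1 h` of the bound is `≥ 1` whenever the bound is invoked. [folklore] -/
theorem dim_ne_zero_of_multiplier {W : WeierstrassCurve ℚ} [W.IsElliptic]
    {E B : AbelianVariety.{0} ℚ} (e : E.geomPoints ≃+ W.geomPoints)
    (h : ∃ (α : E ⟶ B) (β : B ⟶ E) (n : ℤ), n ≠ 0 ∧ α ≫ β = n • 𝟙 E) : B.dim ≠ 0 :=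
  fun hB ↦ not_exists_multiplier_of_dim_eq_zero e hB h

/-- `Bound` is monotone in `C` (the base of the power is `≥ 0`). [folklore] -/
theorem bound_mono_C {κ C C' : ℝ} (h : Bound κ C) (hC : C ≤ C') : Bound κ C' := by
  intro W _ E B e he ℓ hℓ hex hall
  refine (h W E B e he ℓ hℓ hex hall).trans ?_
  exact mul_le_mul_of_nonneg_right hC (Real.rpow_nonneg (by positivity) κ)

/-- `Bound` is monotone in `κ` once `C ≥ 0`: in any instance the base is `≥ 1`
(`dim B ≥ 1` by `dim_ne_zero_of_multiplier`, `max 1 h ≥ 1`). [folklore] -/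
theorem bound_mono_κ {κ κ' C : ℝ} (h : Bound κ C) (hC : 0 ≤ C) (hκ : κ ≤ κ') : Bound κ' C := by
  intro W _ E B e he ℓ hℓ hex hall
  refine (h W E B e he ℓ hℓ hex hall).trans (mul_le_mul_of_nonneg_left ?_ hC)
  have hdim : (1 : ℝ) ≤ B.dim := by
    exact_mod_cast Nat.one_le_iff_ne_zero.2 (dim_ne_zero_of_multiplier e hex)
  have hbase : (1 : ℝ) ≤ (B.dim : ℝ) * max 1 W.stableFaltingsHeight := by
    nlinarith [le_max_left (1 : ℝ) W.stableFaltingsHeight]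
  exact Real.rpow_le_rpow_of_exponent_le hbase hκ

/-- **Normalisation.** The crux is equivalent to its form with `κ ≥ 1` and `C ≥ 0`: a prover may
assume both. (`κ ≥ 1` is moreover NECESSARY, `one_le_kappa_of_weilRestrictionFamily`.) [folklore] -/
theorem iff_normalised :
    EllipticGluingPrimeBound ↔ ∃ κ C : ℝ, 1 ≤ κ ∧ 0 ≤ C ∧ Bound κ C := by
  refine ⟨?_, fun ⟨κ, C, hκ, _, h⟩ ↦ ⟨κ, C, by linarith, h⟩⟩
  rintro ⟨κ, C, hκ, h⟩
  refine ⟨max κ 1, max C 0, le_max_right _ _, le_max_right _ _, ?_⟩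
  exact bound_mono_κ (bound_mono_C h (le_max_left _ _)) (le_max_right _ _) (le_max_left _ _)

/-- `BoundAbove L₀ κ C`: the bound demanded only for primes `ℓ > L₀`. -/
def BoundAbove (L₀ : ℕ) (κ C : ℝ) : Prop :=
  ∀ (W : WeierstrassCurve ℚ) [W.IsElliptic] (E B : AbelianVariety.{0} ℚ)
    (e : E.geomPoints ≃+ W.geomPoints),
    (∀ (σ : Field.absoluteGaloisGroup ℚ) (P : E.geomPoints), e (σ • P) = σ • e P) →
    ∀ ℓ : ℕ, ℓ.Prime → L₀ < ℓ →
      (∃ (α : E ⟶ B) (β : B ⟶ E) (n : ℤ), n ≠ 0 ∧ α ≫ β = n • 𝟙 E) →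
      (∀ (α : E ⟶ B) (β : B ⟶ E) (n : ℤ), α ≫ β = n • 𝟙 E → (ℓ : ℤ) ∣ n) →
        (ℓ : ℝ) ≤ C * ((B.dim : ℝ) * max 1 W.stableFaltingsHeight) ^ κ

/-- **WLOG `ℓ` is large.** For any fixed `L₀` (e.g. `L₀ = 163`, beyond the Mazur–Kenku rational
isogeny degrees, or any bound past which `E[ℓ]` is absolutely irreducible), the crux is equivalent to
its restriction to primes `ℓ > L₀`: small primes are absorbed by `C ↦ max C L₀`, since the base of
the power is `≥ 1` in every instance (`dim_ne_zero_of_multiplier`). [folklore] -/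
theorem iff_boundAbove (L₀ : ℕ) :
    EllipticGluingPrimeBound ↔ ∃ κ C : ℝ, 0 ≤ κ ∧ BoundAbove L₀ κ C := by
  refine ⟨fun ⟨κ, C, hκ, h⟩ ↦ ⟨κ, C, hκ, fun W _ E B e he ℓ hℓ _ hex hall ↦ h W E B e he ℓ hℓ hex hall⟩,
    fun ⟨κ, C, hκ, h⟩ ↦ ⟨κ, max C L₀, hκ, fun W _ E B e he ℓ hℓ hex hall ↦ ?_⟩⟩
  have hdim : (1 : ℝ) ≤ B.dim := by
    exact_mod_cast Nat.one_le_iff_ne_zero.2 (dim_ne_zero_of_multiplier e hex)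
  have hbase : (1 : ℝ) ≤ (B.dim : ℝ) * max 1 W.stableFaltingsHeight := by
    nlinarith [le_max_left (1 : ℝ) W.stableFaltingsHeight]
  have hpow : (1 : ℝ) ≤ ((B.dim : ℝ) * max 1 W.stableFaltingsHeight) ^ κ :=
    Real.one_le_rpow hbase hκ
  by_cases hL : L₀ < ℓ
  · exact (h W E B e he ℓ hℓ hL hex hall).trans
      (mul_le_mul_of_nonneg_right (le_max_left _ _) (by positivity))
  · push Not at hL
    calc (ℓ : ℝ) ≤ L₀ := by exact_mod_cast hL
      _ ≤ max C L₀ * 1 := by rw [mul_one]; exact le_max_right _ _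
      _ ≤ max C L₀ * ((B.dim : ℝ) * max 1 W.stableFaltingsHeight) ^ κ :=
          mul_le_mul_of_nonneg_left hpow ((Nat.cast_nonneg L₀).trans (le_max_right _ _))

/-! ## §2 Load-bearing hypotheses: the crux with one hypothesis dropped, refuted -/

/-- The crux WITHOUT the `∀`-divisibility hypothesis (only "some non-zero multiplier exists").
FALSE: `ellipticGluingPrimeBound_false_without_forallDvd`. -/
def WithoutForallDvd : Prop :=
  ∃ κ C : ℝ, 0 ≤ κ ∧ ∀ (W : WeierstrassCurve ℚ) [W.IsElliptic] (E B : AbelianVariety.{0} ℚ)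
    (e : E.geomPoints ≃+ W.geomPoints),
    (∀ (σ : Field.absoluteGaloisGroup ℚ) (P : E.geomPoints), e (σ • P) = σ • e P) →
    ∀ ℓ : ℕ, ℓ.Prime →
      (∃ (α : E ⟶ B) (β : B ⟶ E) (n : ℤ), n ≠ 0 ∧ α ≫ β = n • 𝟙 E) →
        (ℓ : ℝ) ≤ C * ((B.dim : ℝ) * max 1 W.stableFaltingsHeight) ^ κ

/-- The `∃`-FORM of the crux: "`ℓ` divides SOME non-zero `E`-multiplier of `B`" in place of
"every". FALSE: `not_existsForm` — so the universal quantifier over multipliers cannot be weakened. -/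
def ExistsForm : Prop :=
  ∃ κ C : ℝ, 0 ≤ κ ∧ ∀ (W : WeierstrassCurve ℚ) [W.IsElliptic] (E B : AbelianVariety.{0} ℚ)
    (e : E.geomPoints ≃+ W.geomPoints),
    (∀ (σ : Field.absoluteGaloisGroup ℚ) (P : E.geomPoints), e (σ • P) = σ • e P) →
    ∀ ℓ : ℕ, ℓ.Prime →
      (∃ (α : E ⟶ B) (β : B ⟶ E) (n : ℤ), n ≠ 0 ∧ α ≫ β = n • 𝟙 E ∧ (ℓ : ℤ) ∣ n) →
        (ℓ : ℝ) ≤ C * ((B.dim : ℝ) * max 1 W.stableFaltingsHeight) ^ κ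

/-- The crux WITHOUT `n ≠ 0` in the existence hypothesis. FALSE:
`ellipticGluingPrimeBound_false_without_neZero`. -/
def WithoutNeZero : Prop :=
  ∃ κ C : ℝ, 0 ≤ κ ∧ ∀ (W : WeierstrassCurve ℚ) [W.IsElliptic] (E B : AbelianVariety.{0} ℚ)
    (e : E.geomPoints ≃+ W.geomPoints),
    (∀ (σ : Field.absoluteGaloisGroup ℚ) (P : E.geomPoints), e (σ • P) = σ • e P) →
    ∀ ℓ : ℕ, ℓ.Prime →
      (∃ (α : E ⟶ B) (β : B ⟶ E) (n : ℤ), α ≫ β = n • 𝟙 E) →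
      (∀ (α : E ⟶ B) (β : B ⟶ E) (n : ℤ), α ≫ β = n • 𝟙 E → (ℓ : ℤ) ∣ n) →
        (ℓ : ℝ) ≤ C * ((B.dim : ℝ) * max 1 W.stableFaltingsHeight) ^ κ

/-- The crux WITHOUT `dim B` in the bound: `ℓ ≤ C · (max 1 h_F(W)) ^ κ`. FALSE on paper (Weil
restrictions `Res_{K/ℚ} W`, `[K:ℚ] = ℓ` prime: every prime is attained for a FIXED `W`); in Lean
`not_withoutDim_of_weilRestrictionFamily`. -/
def WithoutDim : Prop :=
  ∃ κ C : ℝ, 0 ≤ κ ∧ ∀ (W : WeierstrassCurve ℚ) [W.IsElliptic] (E B : AbelianVariety.{0} ℚ)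
    (e : E.geomPoints ≃+ W.geomPoints),
    (∀ (σ : Field.absoluteGaloisGroup ℚ) (P : E.geomPoints), e (σ • P) = σ • e P) →
    ∀ ℓ : ℕ, ℓ.Prime →
      (∃ (α : E ⟶ B) (β : B ⟶ E) (n : ℤ), n ≠ 0 ∧ α ≫ β = n • 𝟙 E) →
      (∀ (α : E ⟶ B) (β : B ⟶ E) (n : ℤ), α ≫ β = n • 𝟙 E → (ℓ : ℤ) ∣ n) →
        (ℓ : ℝ) ≤ C * (max 1 W.stableFaltingsHeight) ^ κ

/-- Sanity: `WithoutNeZero` is a genuine strengthening of the crux (it implies it). [folklore] -/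
theorem of_withoutNeZero (h : WithoutNeZero) : EllipticGluingPrimeBound := by
  obtain ⟨κ, C, hκ, h⟩ := h
  exact ⟨κ, C, hκ, fun W _ E B e he ℓ hℓ ⟨α, β, n, _, hc⟩ hall ↦ h W E B e he ℓ hℓ ⟨α, β, n, hc⟩ hall⟩

/-- Sanity: `WithoutForallDvd` is a genuine strengthening of the crux. [folklore] -/
theorem of_withoutForallDvd (h : WithoutForallDvd) : EllipticGluingPrimeBound := by
  obtain ⟨κ, C, hκ, h⟩ := h
  exact ⟨κ, C, hκ, fun W _ E B e he ℓ hℓ hex _ ↦ h W E B e he ℓ hℓ hex⟩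

/-- Sanity: `WithoutDim` is a genuine strengthening of the crux: in every instance `dim B ≥ 1`
(`dim_ne_zero_of_multiplier`), so `C (max 1 h)^κ ≤ (max C 0) (dim B · max 1 h)^κ`. [folklore] -/
theorem of_withoutDim (h : WithoutDim) : EllipticGluingPrimeBound := by
  obtain ⟨κ, C, hκ, h⟩ := h
  refine ⟨κ, max C 0, hκ, fun W _ E B e he ℓ hℓ hex hall ↦ (h W E B e he ℓ hℓ hex hall).trans ?_⟩
  have hdim : (1 : ℝ) ≤ B.dim := by
    exact_mod_cast Nat.one_le_iff_ne_zero.2 (dim_ne_zero_of_multiplier e hex)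
  have hm : (0 : ℝ) ≤ max 1 W.stableFaltingsHeight := zero_le_one.trans (le_max_left _ _)
  have hle : max 1 W.stableFaltingsHeight ≤ (B.dim : ℝ) * max 1 W.stableFaltingsHeight :=
    le_mul_of_one_le_left hm hdim
  calc C * (max 1 W.stableFaltingsHeight) ^ κ
      ≤ max C 0 * (max 1 W.stableFaltingsHeight) ^ κ :=
        mul_le_mul_of_nonneg_right (le_max_left _ _) (Real.rpow_nonneg hm κ)
    _ ≤ max C 0 * ((B.dim : ℝ) * max 1 W.stableFaltingsHeight) ^ κ :=
        mul_le_mul_of_nonneg_left (Real.rpow_le_rpow hm hle hκ) (le_max_right _ _)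

/-- A real number is exceeded by some prime. [folklore] -/
theorem exists_prime_gt (M : ℝ) : ∃ ℓ : ℕ, ℓ.Prime ∧ M < ℓ := by
  obtain ⟨ℓ, hℓM, hℓ⟩ := Nat.exists_infinite_primes (⌈M⌉₊ + 1)
  refine ⟨ℓ, hℓ, ?_⟩
  have h1 : M ≤ ⌈M⌉₊ := Nat.le_ceil M
  have h2 : ((⌈M⌉₊ + 1 : ℕ) : ℝ) ≤ ℓ := by exact_mod_cast hℓM
  push_cast at h2
  linarith

/-- **The `∃`-form is false.** Witness: `W = ofJ 0`, `B = E` its model; for every prime `ℓ` the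
multiplier `ℓ = (ℓ • 𝟙) ≫ 𝟙` is non-zero and divisible by `ℓ`, while the bound is a constant.
[folklore] -/
theorem not_existsForm : ¬ ExistsForm := by
  rintro ⟨κ, C, -, h⟩
  obtain ⟨⟨E, -, e, -, he, -, -⟩⟩ := (WeierstrassCurve.nonempty_abelianVarietyBridge_holds
    (WeierstrassCurve.ofJ (0 : ℚ)) (WeierstrassCurve.ofJ (0 : ℚ)) : Nonempty _)
  obtain ⟨ℓ, hℓ, hM⟩ :=
    exists_prime_gt (C * ((E.dim : ℝ) * max 1 (WeierstrassCurve.ofJ (0 : ℚ)).stableFaltingsHeight) ^ κ)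
  have hmult : ∃ (α : E ⟶ E) (β : E ⟶ E) (n : ℤ), n ≠ 0 ∧ α ≫ β = n • 𝟙 E ∧ (ℓ : ℤ) ∣ n :=
    ⟨(ℓ : ℤ) • 𝟙 E, 𝟙 E, ℓ, by exact_mod_cast hℓ.ne_zero, by rw [Category.comp_id], dvd_rfl⟩
  exact absurd (h (WeierstrassCurve.ofJ (0 : ℚ)) E E e he ℓ hℓ hmult) (not_le.2 hM)

/-- `WithoutForallDvd` implies the `∃`-form (drop the extra divisibility datum). [folklore] -/
theorem existsForm_of_withoutForallDvd (h : WithoutForallDvd) : ExistsForm := by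
  obtain ⟨κ, C, hκ, h⟩ := h
  exact ⟨κ, C, hκ, fun W _ E B e he ℓ hℓ ⟨α, β, n, hn, hc, _⟩ ↦ h W E B e he ℓ hℓ ⟨α, β, n, hn, hc⟩⟩

/-- **Any proof must use the `∀`-divisibility hypothesis**: without it the crux is false
(witness as in `not_existsForm`). [folklore] -/
theorem ellipticGluingPrimeBound_false_without_forallDvd : ¬ WithoutForallDvd :=
  fun h ↦ not_existsForm (existsForm_of_withoutForallDvd h)

/-- **Any proof must use `n ≠ 0`**: without it the crux is false. Witness: `W = ofJ 0`, `E` its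
model, `B = zeroAbelianVariety`; every multiplier factors through `Hom(0, E) = 0`, so equals `0`
(divisible by every `ℓ`), the existence hypothesis is met by `n = 0`, and the bound reads
`ℓ ≤ C · 0 ^ κ` for every prime `ℓ`. [folklore] -/
theorem ellipticGluingPrimeBound_false_without_neZero : ¬ WithoutNeZero := by
  rintro ⟨κ, C, -, h⟩
  obtain ⟨⟨E, -, e, -, he, -, -⟩⟩ := (WeierstrassCurve.nonempty_abelianVarietyBridge_holds
    (WeierstrassCurve.ofJ (0 : ℚ)) (WeierstrassCurve.ofJ (0 : ℚ)) : Nonempty _)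
  obtain ⟨ℓ, hℓ, hM⟩ := exists_prime_gt
    (C * ((zeroAbelianVariety.dim : ℝ) * max 1 (WeierstrassCurve.ofJ (0 : ℚ)).stableFaltingsHeight) ^ κ)
  have hex : ∃ (α : E ⟶ zeroAbelianVariety) (β : zeroAbelianVariety ⟶ E) (n : ℤ),
      α ≫ β = n • 𝟙 E :=
    ⟨0, 0, 0, by rw [Limits.comp_zero, zero_smul]⟩
  have hall : ∀ (α : E ⟶ zeroAbelianVariety) (β : zeroAbelianVariety ⟶ E) (n : ℤ),
      α ≫ β = n • 𝟙 E → (ℓ : ℤ) ∣ n := by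
    intro α β n hn
    rw [AbelianVariety.hom_eq_zero_of_dim_eq_zero_left _ zeroAbelianVariety_dim β,
      Limits.comp_zero] at hn
    rw [(zsmul_id_eq_zero_iff e).1 hn.symm]
    exact dvd_zero _
  exact absurd (h (WeierstrassCurve.ofJ (0 : ℚ)) E zeroAbelianVariety e he ℓ hℓ hex hall) (not_le.2 hM)

/-- **H_Res — the Weil-restriction calibration family** (paper fact, NOT constructible in the tree:
no Weil restriction of group schemes). For non-CM elliptic `W/ℚ` with model `E` and every prime `ℓ`,
`B_ℓ := Res_{K_ℓ/ℚ}(W ⊗ K_ℓ)`, `K_ℓ/ℚ` cyclic of degree `ℓ`, is an abelian variety over `ℚ` of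
dimension `ℓ` with `Hom(E, B_ℓ) = Hom(B_ℓ, E) = End_{K_ℓ}(W) = ℤ` and `E → B_ℓ → E` the trace, so its
`E`-multipliers are exactly `ℓℤ` (BLR *Néron Models* §7.6; MazurRubinSilverberg2007 §1–2, `B_ℓ = ℤ[G] ⊗ E`). (refs: MazurRubinSilverberg2007, Def. 1.1, Prop. 1.6, Thm. 2.1–2.2) -/
def WeilRestrictionFamily : Prop :=
  ∃ (W : WeierstrassCurve ℚ) (_ : W.IsElliptic) (E : AbelianVariety.{0} ℚ)
    (e : E.geomPoints ≃+ W.geomPoints),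
    (∀ (σ : Field.absoluteGaloisGroup ℚ) (P : E.geomPoints), e (σ • P) = σ • e P) ∧
    ∀ ℓ : ℕ, ℓ.Prime → ∃ B : AbelianVariety.{0} ℚ, B.dim = ℓ ∧
      (∃ (α : E ⟶ B) (β : B ⟶ E) (n : ℤ), n ≠ 0 ∧ α ≫ β = n • 𝟙 E) ∧
      (∀ (α : E ⟶ B) (β : B ⟶ E) (n : ℤ), α ≫ β = n • 𝟙 E → (ℓ : ℤ) ∣ n)

/-- **`dim B` cannot be dropped** (modulo H_Res): for the fixed curve of the family every prime `ℓ`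
would be `≤ C (max 1 h)^κ`. [folklore] -/
theorem not_withoutDim_of_weilRestrictionFamily (H : WeilRestrictionFamily) : ¬ WithoutDim := by
  rintro ⟨κ, C, -, h⟩
  obtain ⟨W, _, E, e, he, hfam⟩ := H
  obtain ⟨ℓ, hℓ, hM⟩ := exists_prime_gt (C * (max 1 W.stableFaltingsHeight) ^ κ)
  obtain ⟨B, -, hex, hall⟩ := hfam ℓ hℓ
  exact absurd (h W E B e he ℓ hℓ hex hall) (not_le.2 hM)

/-- Real-analysis core of the exponent calibration: if `ℓ ≤ C (ℓ m)^κ` for every prime `ℓ`, with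
`m ≥ 1` fixed, then `κ ≥ 1` (for `κ < 1`, `ℓ^{1-κ} ≤ C m^κ` is bounded, primes are not).
[folklore] -/
theorem one_le_of_forall_prime_le {κ C m : ℝ} (hm : 1 ≤ m)
    (h : ∀ ℓ : ℕ, ℓ.Prime → (ℓ : ℝ) ≤ C * ((ℓ : ℝ) * m) ^ κ) : 1 ≤ κ := by
  by_contra hκ
  push Not at hκ
  have hpos : 0 < 1 - κ := by linarith
  -- `x ^ (1 - κ) → ∞`, so beyond some `X` it exceeds `C * m ^ κ`
  have hev : ∀ᶠ x : ℝ in atTop, C * m ^ κ + 1 ≤ x ^ (1 - κ) :=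
    (tendsto_rpow_atTop hpos).eventually_ge_atTop _
  obtain ⟨X, hX⟩ := Filter.eventually_atTop.1 hev
  obtain ⟨ℓ, hℓ, hℓX⟩ := exists_prime_gt (max X 1)
  have hℓpos : (0 : ℝ) < ℓ := by exact_mod_cast hℓ.pos
  have h1 := h ℓ hℓ
  have h2 : C * m ^ κ + 1 ≤ (ℓ : ℝ) ^ (1 - κ) := hX ℓ (le_of_lt ((le_max_left _ _).trans_lt hℓX))
  -- rewrite `C (ℓ m)^κ = (C m^κ) ℓ^κ` and `ℓ = ℓ^(1-κ) ℓ^κ`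
  have hsplit : C * ((ℓ : ℝ) * m) ^ κ = (C * m ^ κ) * (ℓ : ℝ) ^ κ := by
    rw [Real.mul_rpow hℓpos.le (by linarith)]; ring
  have hℓsplit : (ℓ : ℝ) = (ℓ : ℝ) ^ (1 - κ) * (ℓ : ℝ) ^ κ := by
    rw [← Real.rpow_add hℓpos]; simp
  have hκpos : 0 < (ℓ : ℝ) ^ κ := Real.rpow_pos_of_pos hℓpos κ
  have h3 : (ℓ : ℝ) ^ (1 - κ) * (ℓ : ℝ) ^ κ ≤ (C * m ^ κ) * (ℓ : ℝ) ^ κ := by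
    rw [← hℓsplit, ← hsplit]; exact h1
  have h4 : (ℓ : ℝ) ^ (1 - κ) ≤ C * m ^ κ := le_of_mul_le_mul_right h3 hκpos
  linarith

/-- **`κ ≥ 1` is forced** (modulo H_Res): the Weil-restriction family has `ℓ = dim B_ℓ` for every
prime `ℓ` and a fixed curve, so `Bound κ C → 1 ≤ κ`. Together with `iff_normalised`: the exponent
range of the crux is exactly `[1, ∞)`, and `κ = 1` is attained on the whole twist class (planner,
rev 4; F1–F2 of the module docstring). [cite: MazurRubinSilverberg2007, Thm. 2.1–2.2] -/
theorem one_le_kappa_of_weilRestrictionFamily (H : WeilRestrictionFamily) {κ C : ℝ}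
    (h : Bound κ C) : 1 ≤ κ := by
  obtain ⟨W, _, E, e, he, hfam⟩ := H
  refine one_le_of_forall_prime_le (le_max_left 1 W.stableFaltingsHeight) (C := C) fun ℓ hℓ ↦ ?_
  obtain ⟨B, hB, hex, hall⟩ := hfam ℓ hℓ
  have := h W E B e he ℓ hℓ hex hall
  rwa [hB] at this

end Summit.ABC.ABC.Theorems.EllipticGluingPrimeBound.Negative

end
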